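import Summits.KontsevichZagierPeriods.Zeta5Search.Barrier.ConeGammaCuspGermLovasz

/-!
# ζ(5) search — BARRIER: CONVEXITY TYPE OF THE CUSP — sub/super-additivity of `σ` from the junction types

HONEST FRAMING (cell `pub-zeta5`): systematic search; no irrationality claim unless kernel-certified. MODEL objects
under Brown–Zudilin's (28)+(30) accounting ([BZ22] = arXiv:2210.03391; (28) observed, not proved); nothing here is a
statement about `ζ(5)`, any `γ` of record, the cone's supremum (C2 OPEN) or the value / sign of the cusp slope or the
modularity type of any junction at a named direction (DATA of the cell); S-E stays CONJECTURED; records in print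
UNMOVED. Prover P2 g30, item «THE JUNCTION VOTE IS A LOVÁSZ EXTENSION» (INBOX 2026-08-27), file (4): the period.

The cusp slope is the sum of the junction votes of one period (`cuspSlope_eq_sum_germ_pairs`, P2 g27), and each
vote is the Lovász extension of its junction's pattern function (`ConeGammaCuspGermLovasz`). HYPOTHESIS SHAPE: every
junction `b_m` (`m + 1 < #bkpts`) admits a finset `M` and a pattern function `f` through which the saving factors near
`θ_{b_m}`, `f` SUBMODULAR (resp. SUPERMODULAR) on the subsets of `M`. Then:
* **`cuspSlope_subadditive_of_submodular`** — `σ(δ + δ') ≤ σ(δ) + σ(δ')` for all `δ, δ'`; with P2 g28's homogeneity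
  **`convexOn_cuspSlope_of_submodular`** (`σ` is CONVEX on `ℝ⁸`), `cuspSlope_symm_nonneg_of_submodular`
  (`σ(δ) + σ(−δ) ≥ 0`), and **`cuspSlope_eq_zero_of_submodular_of_isLocalMax`** — a Regular open-box local maximiser
  of the MODEL `γ` (P2 g23's hypotheses verbatim) whose orbit has submodular junctions only is CUSP-FREE (`σ ≡ 0`;
  RIDER 5's single-wall / `D_b ≥ 0` criterion at every wall count);
* **`cuspSlope_superadditive_of_supermodular`** — `σ(δ) + σ(δ') ≤ σ(δ + δ')`; **`concaveOn_cuspSlope_of_supermodular`**,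
  `cuspSlope_symm_nonpos_of_supermodular`, and **`cuspSlope_conic_nonneg_of_supermodular`** /
  `cuspSlope_add_nonneg_of_supermodular` — the ASCENT DIRECTIONS `{δ : σ(δ) ≥ 0}` form a CONVEX CONE:
  `σ(δ) ≥ 0 ∧ σ(δ') ≥ 0 ⇒ σ(s·δ + t·δ') ≥ 0` for `s, t ≥ 0` — ascent directions ADD UP (the structural form of the
  «thin cone of resonance-preserving ascent directions» at `t*`, P2 g11).
DESK (DATA, `HOME/pub-zeta5-p2/g30/alg/modcensus.py` (C1)/(C3)): no probed direction has junctions of one type only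
(record/41: 76 modular / 8 sub / 34 super / 86 neither), yet `σ(δ+δ') ≥ σ(δ) + σ(δ')` held on 39 of 44 random pairs
at record / flag / argmax-120 / t* and the non-modular junctions near the float-sup region are overwhelmingly
supermodular (t*/480: 548 super, 16 sub, 22 neither). NOT here: the type of any named junction, the sign of `σ`
anywhere, `γ` of record, C2, S-E, `ζ(5)`.
-/

noncomputable section

open Set MeasureTheory Finset
open scoped Topology

namespace Summit.KontsevichZagierPeriods.Zeta5Search.Barrier.ConeGamma

/-! ### Submodular orbits: `σ` subadditive and convex -/

/-- **SUBMODULAR JUNCTIONS ⇒ SUBADDITIVE CUSP SLOPE.** For all 28 forms of `a` positive and `T > 0` a period: if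
every junction of the period admits a pattern function that is SUBMODULAR on its member subsets, then
`cuspSlope a T (δ + δ') ≤ cuspSlope a T δ + cuspSlope a T δ'` for all displacements `δ, δ'`. -/
theorem cuspSlope_subadditive_of_submodular {a : Dir} (hpos : ∀ k, 0 < h28 a k) {T : ℝ} (hT : 0 < T)
    (hper : ∀ k : Fin 28, ∃ z : ℤ, T * h28 a k = z)
    (hjun : ∀ m, m + 1 < (bkpts a T).card → ∃ (M : Finset (Fin 28)) (f : Finset (Fin 28) → ℝ),
      (∀ Δ : Fin 8 → ℝ, (∀ k, |phiForm Δ k| < 1) → (∀ k, |phiForm Δ k| < wallDist a T) →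
        (torusN (bkpt a T m • sParam a + Δ) : ℝ) = f (M.filter fun k => 0 ≤ phiForm Δ k)) ∧
      (∀ A B : Finset (Fin 28), A ⊆ M → B ⊆ M → f (A ∪ B) + f (A ∩ B) ≤ f A + f B))
    (δ δ' : Fin 8 → ℝ) :
    cuspSlope a T (δ + δ') ≤ cuspSlope a T δ + cuspSlope a T δ' := by
  obtain ⟨ρ₁, hρ₁, h1₁, h2₁, hg₁⟩ := exists_admissible_scale hpos hT δ
  obtain ⟨ρ₂, hρ₂, h1₂, h2₂, hg₂⟩ := exists_admissible_scale hpos hT δ'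
  obtain ⟨ρ₃, hρ₃, h1₃, h2₃, hg₃⟩ := exists_admissible_scale hpos hT (δ + δ')
  rw [cuspSlope_eq_sum_germ_pairs hpos hT hper δ hρ₁ h1₁ h2₁ hg₁,
    cuspSlope_eq_sum_germ_pairs hpos hT hper δ' hρ₂ h1₂ h2₂ hg₂,
    cuspSlope_eq_sum_germ_pairs hpos hT hper (δ + δ') hρ₃ h1₃ h2₃ hg₃, ← Finset.sum_add_distrib]
  refine Finset.sum_le_sum fun m hm => ?_
  have hm' : m + 1 < (bkpts a T).card := by have := Finset.mem_range.mp hm; omega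
  obtain ⟨M, f, hf, hsub⟩ := hjun m hm'
  exact germ_pair_subadditive_of_submodular hpos (bkpt_mem (by omega)) hf hsub δ δ' hρ₁ h1₁ h2₁ hρ₂ h1₂ h2₂
    hρ₃ h1₃ h2₃

/-- **… hence CONVEX** (subadditive and degree-1 homogeneous, P2 g28's `cuspSlope_smul`). -/
theorem convexOn_cuspSlope_of_submodular {a : Dir} (hpos : ∀ k, 0 < h28 a k) {T : ℝ} (hT : 0 < T)
    (hper : ∀ k : Fin 28, ∃ z : ℤ, T * h28 a k = z)
    (hjun : ∀ m, m + 1 < (bkpts a T).card → ∃ (M : Finset (Fin 28)) (f : Finset (Fin 28) → ℝ),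
      (∀ Δ : Fin 8 → ℝ, (∀ k, |phiForm Δ k| < 1) → (∀ k, |phiForm Δ k| < wallDist a T) →
        (torusN (bkpt a T m • sParam a + Δ) : ℝ) = f (M.filter fun k => 0 ≤ phiForm Δ k)) ∧
      (∀ A B : Finset (Fin 28), A ⊆ M → B ⊆ M → f (A ∪ B) + f (A ∩ B) ≤ f A + f B)) :
    ConvexOn ℝ Set.univ (cuspSlope a T) := by
  refine ⟨convex_univ, fun x _ y _ s t hs ht hst => ?_⟩
  have hsub := cuspSlope_subadditive_of_submodular hpos hT hper hjun (s • x) (t • y)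
  rcases hs.eq_or_lt with rfl | hs'
  · simp only [zero_smul, zero_add] at hst ⊢
    rw [hst, one_smul, one_smul]
  rcases ht.eq_or_lt with rfl | ht'
  · simp only [zero_smul, add_zero] at hst ⊢
    rw [hst, one_smul, one_smul]
  rw [cuspSlope_smul hpos hT hper x hs', cuspSlope_smul hpos hT hper y ht'] at hsub
  simpa only [smul_eq_mul] using hsub

/-- **… and the symmetric part is non-negative**: `0 ≤ σ(δ) + σ(−δ)` for every `δ`. -/
theorem cuspSlope_symm_nonneg_of_submodular {a : Dir} (hpos : ∀ k, 0 < h28 a k) {T : ℝ} (hT : 0 < T)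
    (hper : ∀ k : Fin 28, ∃ z : ℤ, T * h28 a k = z)
    (hjun : ∀ m, m + 1 < (bkpts a T).card → ∃ (M : Finset (Fin 28)) (f : Finset (Fin 28) → ℝ),
      (∀ Δ : Fin 8 → ℝ, (∀ k, |phiForm Δ k| < 1) → (∀ k, |phiForm Δ k| < wallDist a T) →
        (torusN (bkpt a T m • sParam a + Δ) : ℝ) = f (M.filter fun k => 0 ≤ phiForm Δ k)) ∧
      (∀ A B : Finset (Fin 28), A ⊆ M → B ⊆ M → f (A ∪ B) + f (A ∩ B) ≤ f A + f B))
    (δ : Fin 8 → ℝ) : 0 ≤ cuspSlope a T δ + cuspSlope a T (-δ) := by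
  have h := cuspSlope_subadditive_of_submodular hpos hT hper hjun δ (-δ)
  rwa [add_neg_cancel, cuspSlope_zero] at h

/-- **A LOCAL MAXIMISER WITH SUBMODULAR JUNCTIONS ONLY IS CUSP-FREE.** At a Regular OPEN-box direction with a period
`T`, `Q = C₁ + δ₂₈ − Φ > 0`, which is a local maximiser of the MODEL `γ` (P2 g23's hypotheses of
`cuspSlope_nonpos_of_isLocalMax`): if every junction of the period admits a submodular pattern function, then
`cuspSlope a T δ = 0` for EVERY `δ`. (All slopes are `≤ 0` at a maximiser; their symmetric parts are `≥ 0`.) -/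
theorem cuspSlope_eq_zero_of_submodular_of_isLocalMax {a : Dir}
    (hopen : ∀ j : Fin 7, 0 < sParam a j.succ ∧ sParam a j.succ < sParam a 0)
    {T : ℝ} (hT : 0 < T) (hper : ∀ k : Fin 28, ∃ z : ℤ, T * h28 a k = z)
    (hQ : 0 < C1 a + delta28 a - phi30 a) (hreg : Regular a) (hmax : IsLocalMax gamma a)
    (hjun : ∀ m, m + 1 < (bkpts a T).card → ∃ (M : Finset (Fin 28)) (f : Finset (Fin 28) → ℝ),
      (∀ Δ : Fin 8 → ℝ, (∀ k, |phiForm Δ k| < 1) → (∀ k, |phiForm Δ k| < wallDist a T) →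
        (torusN (bkpt a T m • sParam a + Δ) : ℝ) = f (M.filter fun k => 0 ≤ phiForm Δ k)) ∧
      (∀ A B : Finset (Fin 28), A ⊆ M → B ⊆ M → f (A ∪ B) + f (A ∩ B) ≤ f A + f B))
    (δ : Fin 8 → ℝ) : cuspSlope a T δ = 0 := by
  have hpos := h28_pos_of_openBox hopen
  have h1 := cuspSlope_nonpos_of_isLocalMax hopen hT hper δ hQ hreg hmax
  have h2 := cuspSlope_nonpos_of_isLocalMax hopen hT hper (-δ) hQ hreg hmax
  have h3 := cuspSlope_symm_nonneg_of_submodular hpos hT hper hjun δ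
  linarith

/-! ### Supermodular orbits: `σ` superadditive and concave — ascent directions add up -/

/-- **SUPERMODULAR JUNCTIONS ⇒ SUPERADDITIVE CUSP SLOPE**: `cuspSlope a T δ + cuspSlope a T δ' ≤ cuspSlope a T (δ + δ')`. -/
theorem cuspSlope_superadditive_of_supermodular {a : Dir} (hpos : ∀ k, 0 < h28 a k) {T : ℝ} (hT : 0 < T)
    (hper : ∀ k : Fin 28, ∃ z : ℤ, T * h28 a k = z)
    (hjun : ∀ m, m + 1 < (bkpts a T).card → ∃ (M : Finset (Fin 28)) (f : Finset (Fin 28) → ℝ),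
      (∀ Δ : Fin 8 → ℝ, (∀ k, |phiForm Δ k| < 1) → (∀ k, |phiForm Δ k| < wallDist a T) →
        (torusN (bkpt a T m • sParam a + Δ) : ℝ) = f (M.filter fun k => 0 ≤ phiForm Δ k)) ∧
      (∀ A B : Finset (Fin 28), A ⊆ M → B ⊆ M → f A + f B ≤ f (A ∪ B) + f (A ∩ B)))
    (δ δ' : Fin 8 → ℝ) :
    cuspSlope a T δ + cuspSlope a T δ' ≤ cuspSlope a T (δ + δ') := by
  obtain ⟨ρ₁, hρ₁, h1₁, h2₁, hg₁⟩ := exists_admissible_scale hpos hT δ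
  obtain ⟨ρ₂, hρ₂, h1₂, h2₂, hg₂⟩ := exists_admissible_scale hpos hT δ'
  obtain ⟨ρ₃, hρ₃, h1₃, h2₃, hg₃⟩ := exists_admissible_scale hpos hT (δ + δ')
  rw [cuspSlope_eq_sum_germ_pairs hpos hT hper δ hρ₁ h1₁ h2₁ hg₁,
    cuspSlope_eq_sum_germ_pairs hpos hT hper δ' hρ₂ h1₂ h2₂ hg₂,
    cuspSlope_eq_sum_germ_pairs hpos hT hper (δ + δ') hρ₃ h1₃ h2₃ hg₃, ← Finset.sum_add_distrib]
  refine Finset.sum_le_sum fun m hm => ?_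
  have hm' : m + 1 < (bkpts a T).card := by have := Finset.mem_range.mp hm; omega
  obtain ⟨M, f, hf, hsuper⟩ := hjun m hm'
  exact germ_pair_superadditive_of_supermodular hpos (bkpt_mem (by omega)) hf hsuper δ δ' hρ₁ h1₁ h2₁ hρ₂ h1₂
    h2₂ hρ₃ h1₃ h2₃

/-- **… hence CONCAVE.** -/
theorem concaveOn_cuspSlope_of_supermodular {a : Dir} (hpos : ∀ k, 0 < h28 a k) {T : ℝ} (hT : 0 < T)
    (hper : ∀ k : Fin 28, ∃ z : ℤ, T * h28 a k = z)
    (hjun : ∀ m, m + 1 < (bkpts a T).card → ∃ (M : Finset (Fin 28)) (f : Finset (Fin 28) → ℝ),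
      (∀ Δ : Fin 8 → ℝ, (∀ k, |phiForm Δ k| < 1) → (∀ k, |phiForm Δ k| < wallDist a T) →
        (torusN (bkpt a T m • sParam a + Δ) : ℝ) = f (M.filter fun k => 0 ≤ phiForm Δ k)) ∧
      (∀ A B : Finset (Fin 28), A ⊆ M → B ⊆ M → f A + f B ≤ f (A ∪ B) + f (A ∩ B))) :
    ConcaveOn ℝ Set.univ (cuspSlope a T) := by
  refine ⟨convex_univ, fun x _ y _ s t hs ht hst => ?_⟩
  have hsup := cuspSlope_superadditive_of_supermodular hpos hT hper hjun (s • x) (t • y)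
  rcases hs.eq_or_lt with rfl | hs'
  · simp only [zero_smul, zero_add] at hst ⊢
    rw [hst, one_smul, one_smul]
  rcases ht.eq_or_lt with rfl | ht'
  · simp only [zero_smul, add_zero] at hst ⊢
    rw [hst, one_smul, one_smul]
  rw [cuspSlope_smul hpos hT hper x hs', cuspSlope_smul hpos hT hper y ht'] at hsup
  simpa only [smul_eq_mul] using hsup

/-- **… and the symmetric part is non-positive**: `σ(δ) + σ(−δ) ≤ 0` for every `δ`. -/
theorem cuspSlope_symm_nonpos_of_supermodular {a : Dir} (hpos : ∀ k, 0 < h28 a k) {T : ℝ} (hT : 0 < T)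
    (hper : ∀ k : Fin 28, ∃ z : ℤ, T * h28 a k = z)
    (hjun : ∀ m, m + 1 < (bkpts a T).card → ∃ (M : Finset (Fin 28)) (f : Finset (Fin 28) → ℝ),
      (∀ Δ : Fin 8 → ℝ, (∀ k, |phiForm Δ k| < 1) → (∀ k, |phiForm Δ k| < wallDist a T) →
        (torusN (bkpt a T m • sParam a + Δ) : ℝ) = f (M.filter fun k => 0 ≤ phiForm Δ k)) ∧
      (∀ A B : Finset (Fin 28), A ⊆ M → B ⊆ M → f A + f B ≤ f (A ∪ B) + f (A ∩ B)))
    (δ : Fin 8 → ℝ) : cuspSlope a T δ + cuspSlope a T (-δ) ≤ 0 := by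
  have h := cuspSlope_superadditive_of_supermodular hpos hT hper hjun δ (-δ)
  rwa [add_neg_cancel, cuspSlope_zero] at h

/-- **ASCENT DIRECTIONS ADD UP.** With supermodular junctions only, the ascent set `{δ : 0 ≤ σ(δ)}` is a CONVEX CONE:
`0 ≤ σ(δ)`, `0 ≤ σ(δ')`, `s, t ≥ 0` give `0 ≤ σ(s·δ + t·δ')`. (A structural reading of the thin cone of ascent
directions at resonant lattice directions; which directions ascend at a named direction is DATA.) -/
theorem cuspSlope_conic_nonneg_of_supermodular {a : Dir} (hpos : ∀ k, 0 < h28 a k) {T : ℝ} (hT : 0 < T)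
    (hper : ∀ k : Fin 28, ∃ z : ℤ, T * h28 a k = z)
    (hjun : ∀ m, m + 1 < (bkpts a T).card → ∃ (M : Finset (Fin 28)) (f : Finset (Fin 28) → ℝ),
      (∀ Δ : Fin 8 → ℝ, (∀ k, |phiForm Δ k| < 1) → (∀ k, |phiForm Δ k| < wallDist a T) →
        (torusN (bkpt a T m • sParam a + Δ) : ℝ) = f (M.filter fun k => 0 ≤ phiForm Δ k)) ∧
      (∀ A B : Finset (Fin 28), A ⊆ M → B ⊆ M → f A + f B ≤ f (A ∪ B) + f (A ∩ B)))
    {δ δ' : Fin 8 → ℝ} (hδ : 0 ≤ cuspSlope a T δ) (hδ' : 0 ≤ cuspSlope a T δ') {s t : ℝ} (hs : 0 ≤ s)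
    (ht : 0 ≤ t) : 0 ≤ cuspSlope a T (s • δ + t • δ') := by
  have hsup := cuspSlope_superadditive_of_supermodular hpos hT hper hjun (s • δ) (t • δ')
  have hs1 : 0 ≤ cuspSlope a T (s • δ) := by
    rcases hs.eq_or_lt with rfl | hs'
    · rw [zero_smul, cuspSlope_zero]
    · rw [cuspSlope_smul hpos hT hper δ hs']; exact mul_nonneg hs hδ
  have ht1 : 0 ≤ cuspSlope a T (t • δ') := by
    rcases ht.eq_or_lt with rfl | ht'
    · rw [zero_smul, cuspSlope_zero]
    · rw [cuspSlope_smul hpos hT hper δ' ht']; exact mul_nonneg ht hδ'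
  linarith


/-- **ASCENT DIRECTIONS ADD UP** (the case `s = t = 1`): `0 ≤ σ(δ)` and `0 ≤ σ(δ')` give `0 ≤ σ(δ + δ')`. -/
theorem cuspSlope_add_nonneg_of_supermodular {a : Dir} (hpos : ∀ k, 0 < h28 a k) {T : ℝ} (hT : 0 < T)
    (hper : ∀ k : Fin 28, ∃ z : ℤ, T * h28 a k = z)
    (hjun : ∀ m, m + 1 < (bkpts a T).card → ∃ (M : Finset (Fin 28)) (f : Finset (Fin 28) → ℝ),
      (∀ Δ : Fin 8 → ℝ, (∀ k, |phiForm Δ k| < 1) → (∀ k, |phiForm Δ k| < wallDist a T) →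
        (torusN (bkpt a T m • sParam a + Δ) : ℝ) = f (M.filter fun k => 0 ≤ phiForm Δ k)) ∧
      (∀ A B : Finset (Fin 28), A ⊆ M → B ⊆ M → f A + f B ≤ f (A ∪ B) + f (A ∩ B)))
    {δ δ' : Fin 8 → ℝ} (hδ : 0 ≤ cuspSlope a T δ) (hδ' : 0 ≤ cuspSlope a T δ') :
    0 ≤ cuspSlope a T (δ + δ') := by
  have h := cuspSlope_conic_nonneg_of_supermodular hpos hT hper hjun hδ hδ' zero_le_one zero_le_one
  rwa [one_smul, one_smul] at h

end Summit.KontsevichZagierPeriods.Zeta5Search.Barrier.ConeGamma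

end
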